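import Summits.CriticalPhenomena.CardyFormulaZ2.Theorems.CardyComplexConeParafermionToSLESixFamiliesDiamondDefsR3
import Summits.CriticalPhenomena.CardyFormulaZ2.Theorems.CardyComplexConeParafermionToSLESixFamiliesDiamondTraceTurn
import HarnessLib

/-!
# Vocabulary of line `potential-darboux-picard-diamond`, part 3 (reshape r4): crux `ParafermionToSLESixFamilies` (stmt-CriticalPhenomena-11389)

Third definitions module of the line (lead c5, after wave 3). Wave 3 CLOSED S1t (`stub_freeSideTurnCount`, p153275) and S4v
(`stub_boundaryIdentification`, p151443 — hence the whole engine S4′, `stub_identifyPotentialPh`), and the S1″ assembly worker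
showed that `FreeSideTurnCount` as typed (r3, `∃ j`) is satisfiable vacuously and, even per orientation, too weak for the
assembly: (DIR) needs the passage phases of ALL sides — free AND wired — related to ONE global anchor through the explicit
turning function `diamondTau` (p144600). Hence the two statements of reshape r4, typed by that worker (elaboration-checked):
`BoundaryDartPhase` (S1p) and `DiamondArcsConnected` (S1c, the hypotheses (H1)/(H2) of `passesCorner_iff_reachable_of_touch`,
eventually along a diamond family); S1‴ `stub_exactPotentialTracePh3 : BoundaryDartPhase → DiamondArcsConnected →
ExactPotentialTracePh` replaces S1″. NOTHING here is asserted except the registered glue `freeSideTurnCount_of_forall_orientation`.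
-/

noncomputable section

namespace Summit.CriticalPhenomena.CardyFormulaZ2.Cruxes.ParafermionToSLESixFamilies.PotentialDarbouxPicardDiamond

open scoped Topology NNReal ENNReal BigOperators
open Filter MeasureTheory Set Metric Complex
open Literature.Probability Literature.Probability.LatticeModels Literature.Probability.Percolation
open Literature.Probability.LatticeModels.DiscreteDobrushin
open Literature.Probability.RandomPlanarGeometry
open Summit.CriticalPhenomena.CardyFormulaZ2.Cruxes.ParafermionToSLESixFamilies.IicTraceFluxPairing

/-- **S1p (r4) — THE PHASE OF THE EXPLORATION AT THE FIRST BOUNDARY DART OF EVERY STRAIGHT SIDE, FREE AND WIRED, ANCHORED TO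
THE FRAME DIRECTION.** For a marked diamond in its frame (`dRot c`, half-widths `α, β`) and an admissible family there is
a mesh-dependent unit `u δ` such that for every oriented boundary segment `[p, q]` on the arc `D.arc i` (`i = 1`: free,
dual-wired; `i = 0`: wired) and trim `η > 0`, eventually in `δ`: at every site `x` within `3δ` of the segment and `η`-away
from its endpoints, and every corner `(x, j)` with inner face whose two OUTWARD neighbours `x + u_{j+1}`, `x + u_{j+2}` lie on
the discrete arc of the side (free: `x` off `B`, both neighbours on `B` — the first touch dart of a touch site; wired: `x`
and both neighbours on `A` — the first of the three consecutive `A`-corner darts of a tip cell), at every passage time `t`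
of `(x, j)` before the exit the passage phase satisfies
`exp(-iπ·turnCount/6) · i^j · exp(∓iπ/6) = u δ · diamondTau c α β (D.pt 0) (D.pt 1) p q` (`−` free, `+` wired).
Equivalently: `turnCount ≡ T₀(δ) + k + 5 − 2m` (free) / `+ k + 7 − 2m` (wired) `(mod 12)`, `k` the frame side index of
`[p, q]`, `m` the number of marks weakly before `p` — one quarter turn per diamond corner all the way round, no jump at
`b`, a full turn at `a`; checked against wave 1's exact enumeration (`R = 4`, marks `0.3/−0.7`: free NE/NW/SW increments at
`−30°, 30°, 90°`, wired SW/SE/NE `A`-chain increments at `150°, −150°, −90°`, all `= e^{-i5π/6} · diamondTau`; hand-traced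
`T = 1` at the wired dart `((2,1),3)` and `T = −3` at the free dart `((0,2),3)` near `a`). -/
def BoundaryDartPhase : Prop :=
  ∀ (D : DobrushinDomain) (c : ℂ) (α β : ℝ), 0 < α → 0 < β →
    D.carrier = {z | |((z - c) * exp (-(Real.pi / 4 : ℝ) * I)).re| < α ∧ |((z - c) * exp (-(Real.pi / 4 : ℝ) * I)).im| < β} →
    ∀ (Λ : ℝ → DiscreteDobrushin), IsFamily D Λ → ∃ u : ℝ → ℂ, (∀ δ : ℝ, ‖u δ‖ = 1) ∧
      ∀ (i : Fin 2) (p q : ℂ), IsBdrySegment D p q → segment ℝ p q ⊆ D.arc i → ∀ η : ℝ, 0 < η →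
        ∀ᶠ δ in 𝓝[>] (0:ℝ), ∀ (hδ : (Λ δ).IsZdAdmissible) (x : Site 2) (j : Fin 4),
          infDist (meshPoint δ x) (segment ℝ p q) ≤ 3 * δ → η ≤ dist (meshPoint δ x) p → η ≤ dist (meshPoint δ x) q →
          (Λ δ).IsInnerFace (faceAt x j) →
          (i = 1 → x ∉ (Λ δ).zdArcB ∧ x + cornerUnit (j + 1) ∈ (Λ δ).zdArcB ∧ x + cornerUnit (j + 2) ∈ (Λ δ).zdArcB) →
          (i = 0 → x ∈ (Λ δ).zdArcA ∧ x + cornerUnit (j + 1) ∈ (Λ δ).zdArcA ∧ x + cornerUnit (j + 2) ∈ (Λ δ).zdArcA) →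
          ∀ (ω : BondConfig (Site 2)) (t : ℕ), t < exitTime hδ ω →
            cornerOrbit ((Λ δ).bcBondConfig ω) (startCorner hδ) t = (x, j) →
            Complex.exp (-(Real.pi / 6 * turnCount ((Λ δ).bcBondConfig ω) (startCorner hδ) t : ℝ) * I) * I ^ (j : ℕ) *
                Complex.exp (((if i = 1 then -(Real.pi / 6) else Real.pi / 6 : ℝ) : ℂ) * I) =
              u δ * diamondTau c α β (D.pt 0) (D.pt 1) p q

/-- **S1c — THE DISCRETE ARCS OF A DIAMOND DISCRETISATION ARE CONNECTED, EVENTUALLY** ((H1)/(H2) of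
`passesCorner_iff_reachable_of_touch`): along an admissible family of a marked diamond, for all small `δ` the wired
discrete arc is connected through `Ω_δ` and the dual-wired one through lattice edges (the discrete boundary is the
two-layer staircase cycle with pendant / flat corners; exactly two `A`–`B` edges, each on an inner face, cut it into two
arcs). -/
def DiamondArcsConnected : Prop :=
  ∀ (D : DobrushinDomain), IsMarkedDiamond D → ∀ (Λ : ℝ → DiscreteDobrushin), IsFamily D Λ →
    ∀ᶠ δ in 𝓝[>] (0:ℝ), ((discreteDomainGraph D.carrier δ).induce (Λ δ).zdArcA).Preconnected ∧
      ((zdGraph 2).induce (Λ δ).zdArcB).Preconnected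

/-- Glue (registered): the `∀ j`-form of the turn-count statement implies `FreeSideTurnCount` as typed (the r3 statement quantified
`∃ j`, which wave 3 showed to be satisfiable vacuously by an inward orientation; the r4 statement `BoundaryDartPhase` is the
cross-side-consistent, free-and-wired strengthening that S1‴ consumes). -/
theorem freeSideTurnCount_of_forall_orientation : (∀ (D : DobrushinDomain), IsMarkedDiamond D → ∀ (Λ : ℝ → DiscreteDobrushin), IsFamily D Λ → ∀ p q : ℂ,
    IsBdrySegment D p q → segment ℝ p q ⊆ D.arc 1 → ∀ η : ℝ, 0 < η → ∀ᶠ δ in 𝓝[>] (0:ℝ),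
      ∀ hδ : (Λ δ).IsZdAdmissible, ∀ j : Fin 4, ∃ T : ℤ, ∀ u : Site 2,
        infDist (meshPoint δ u) (segment ℝ p q) ≤ 3 * δ → η ≤ dist (meshPoint δ u) p → η ≤ dist (meshPoint δ u) q →
        u ∉ (Λ δ).zdArcB → u + cornerUnit (j + 1) ∈ (Λ δ).zdArcB →
        ∀ (ω : BondConfig (Site 2)) (t : ℕ), t < exitTime hδ ω →
          cornerOrbit ((Λ δ).bcBondConfig ω) (startCorner hδ) t = (u, j) →
          turnCount ((Λ δ).bcBondConfig ω) (startCorner hδ) t = T) → FreeSideTurnCount := by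
  intro h D hD Λ hΛ p q hpq hsub η hη
  filter_upwards [h D hD Λ hΛ p q hpq hsub η hη] with δ hδ hadm
  obtain ⟨T, hT⟩ := hδ hadm 0
  exact ⟨0, T, hT⟩

end Summit.CriticalPhenomena.CardyFormulaZ2.Cruxes.ParafermionToSLESixFamilies.PotentialDarbouxPicardDiamond

end
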